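/-
Copyright (c) 2026 the pub-hodgecm-mathlib formalisation cell (harness21).  Prover seat hodgecm-mathlib-K2E4-p14 (g5), Track B ∕ K2-LIT, h413 =
`stmt-HodgeConjecture-24833`, line `K2_E1_TraceFormulaBeta`, campaign «EIS-RANK-ONE» rung R6f(iii); DEAL `K2E1TorusHeightMellinU2` of the dealer K2E1-plan (g3)
2026-09-04T05:07:46Z («YES to the N = 2 sequel — 5Res runs on the same rails as 12R3»): the MIRROR torus factor of `U(J₂)`.
-/
import Summits.HodgeConjecture.HodgeConjecture.Theorems.K2E1TorusHeightMellin            -- ★ p857517 (this seat): `setLIntegral_indicator_lt_rpow_neg`, `indicator_lt_rpow_neg_eq_comp_logNorm`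
import Summits.HodgeConjecture.HodgeConjecture.Theorems.K2E1BorelParabolicIntegralU2     -- ★ p857484 (K2E4-p11 g3): `H(b) = ‖d₀ b‖` (every `N`), the `≤`-side torus factor at `N = 2`
import HarnessLib

/-!
# K2·E1 — `K2E1TorusHeightMellinU2`: THE MIRROR TORUS FACTOR `∫ 𝟙{C₀ < H} H^{-σ} w_T dμ_T = K₁ · C₀^{-σ}∕σ` ON `U(J₂)`
# (campaign «EIS-RANK-ONE», rung R6f(iii) at `N = 2`: the `{T < H}` Maass–Selberg terms of `U(Φ₂)` in the covering-weight currency)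

Track B ∕ K2-LIT, crux h413 = `stmt-HodgeConjecture-24833`, route of record `HCCMUnconditional`; cell `hodgecm-mathlib`, squad K2, ENGINE E1.  Prover seat
`hodgecm-mathlib-K2E4-p14` (g5); DEAL of the dealer K2E1-plan (g3) 2026-09-04T05:07:46Z.  THEOREMS ONLY (no `def`, no `instance`, no notation, no named-fact hypothesis, no
`sorry`); lane `--supports stmt-HodgeConjecture-24833 --as helper` (count-neutral).  Closes no socket.

WHAT.  `E/F` quadratic with involution `c` (`c² = 1`), `T(𝔸_F) = torusInBorel F E c 2 = {diag(d₀, (c d₀)⁻¹)}` the diagonal torus of `U(J₂)`, `T(F)_T` its rational points, `μ_T` a Haar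
measure, `H` the Borel height (★ `borelHeight`; `H(t) = ‖d₀ t‖_{𝔸_E}` by ★ p857484 `borelHeight_coe_eq_ideleNorm_diagUnit`).  The `≤`-side torus factor at `N = 2`,
`∫⁻ 𝟙{H ≤ C₀} H^σ w_T dμ_T = K₁ · C₀^σ∕σ`, is ★ p857484 `exists_lintegral_indicator_borelHeight_rpow_mul_weight_torus_eq_two` and is NOT restated here.  This file is its MIRROR:
**`exists_lintegral_indicator_borelHeight_rpow_neg_mul_weight_torus_eq_two`** — one constant `K₁ ∈ (0, ∞)` with, for every covering weight `w_T` of `T(F)_T` (i.e. "`∫_{T(F)∖T(𝔸_F)}`"),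
every `C₀ > 0` and the given real `σ > 0`,
  `∫⁻_{T(𝔸_F)} 𝟙{C₀ < H(t)} · H(t)^{-σ} · w_T(t) dμ_T = K₁ · C₀^{-σ} ∕ σ`
— the torus IS the idele group at `N = 2` (★ `UnitaryGroupTorusLineUnfoldingTwo.exists_lintegral_comp_diagUnitZero_mul_weight_eq_setLIntegral_two`, trivial fibre), and on an idele
class domain the mirror Tate formula ★ p857517 `setLIntegral_indicator_lt_rpow_neg` gives `V · C₀^{-σ}∕σ`.  With ★ p857484 (the `≤` side) these are the two `ℝ≥0∞` shapes of the
four Maass–Selberg terms of `U(Φ₂)` [MoeglinWaldspurger1995, IV.2.1; Arthur1980TraceFormulaII, §4]; the complex-weighted Bochner heads are ★ p857517 §2 (`K`-generic, on `E^×∖𝕀_E`).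
HONEST LABEL: HC_CM is proved only modulo the 7 printed citations (2 remaining named inputs: hLiu418 = `stmt-HodgeConjecture-24832`, h413 = `stmt-HodgeConjecture-24833`) until rung 0
closes; this file asserts no named fact and closes no socket.
References: [Rogawski1990] §7.3 (p. 98), Prop. 7.3.1 · [CasselsFrohlichANT1967] J. Tate, Ch. XV §4.4 (proof of Thm. 4.4.1) · [MoeglinWaldspurger1995] IV.2.1 · [Arthur1980TraceFormulaII] §4.
-/

set_option autoImplicit false
-- the mandated namespace repeats the single-problem summit's segment (`HodgeConjecture.HodgeConjecture`)
set_option linter.dupNamespace false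

noncomputable section

open MeasureTheory Measure NumberField IsDedekindDomain Set
open scoped ENNReal NNReal
open Literature.MeasureTheory.Group Literature.NumberTheory
open Literature.NumberTheory.Automorphic Literature.NumberTheory.Automorphic.UnitaryGroup
open Summit.HodgeConjecture.HodgeConjecture.Cruxes.H413.K2E1TorusHeightMellin
open Summit.HodgeConjecture.HodgeConjecture.Cruxes.H413.K2E1BorelParabolicIntegralU2 (borelHeight_coe_eq_ideleNorm_diagUnit)

namespace Summit.HodgeConjecture.HodgeConjecture.Cruxes.H413.K2E1TorusHeightMellinU2

variable {F E : Type} [Field F] [NumberField F] [Field E] [NumberField E] [Algebra F E] {c : E ≃ₐ[F] E}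
variable [MeasurableSpace (quasiSplit F E c 2).Adelic] [BorelSpace (quasiSplit F E c 2).Adelic]

/-- **THE MIRROR TORUS FACTOR AT `N = 2`.**  For `c² = 1`, a Haar measure `μ_T` on `T(𝔸_F) ≤ U(J₂)(𝔸_F)` and `σ > 0` there is `K₁ ∈ (0, ∞)` with
  `∫⁻_{T(𝔸_F)} 𝟙{C₀ < H(t)} · H(t)^{-σ} · w_T(t) dμ_T = K₁ · C₀^{-σ} ∕ σ`
for EVERY covering weight `w_T` of the rational torus `T(F)_T` and every `C₀ > 0`: `H(t) = ‖d₀ t‖` (★ p857484), the torus-to-idele unfolding along the ISOMORPHISM `d₀` (★ (C-torus)₂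
`exists_lintegral_comp_diagUnitZero_mul_weight_eq_setLIntegral_two`; the integrand `𝟙{C₀ < ‖x‖} ‖x‖^{-σ}` is a Borel function of `log ‖x‖`, hence `E^×`-invariant) and the mirror
Tate formula ★ p857517 `setLIntegral_indicator_lt_rpow_neg`.  The twin of ★ p857484 `exists_lintegral_indicator_borelHeight_rpow_mul_weight_torus_eq_two`.
[cite: Rogawski1990, §7.3 (p. 98)] [cite: CasselsFrohlichANT1967, Ch. XV Thm. 4.4.1 (proof)] [cite: MoeglinWaldspurger1995, IV.2.1] -/
theorem exists_lintegral_indicator_borelHeight_rpow_neg_mul_weight_torus_eq_two (hc : c * c = 1)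
    (μT : Measure (torusInBorel F E c 2)) [μT.IsHaarMeasure] {σ : ℝ} (hσ : 0 < σ) :
    ∃ K₁ : ℝ≥0∞, K₁ ≠ 0 ∧ K₁ ≠ ∞ ∧
      ∀ wT : torusInBorel F E c 2 → ℝ≥0∞,
        IsCoveringWeight ↥((((quasiSplit F E c 2).arithmeticSubgroup).subgroupOf (borelAdelic F E c 2)).subgroupOf
          (torusInBorel F E c 2)) wT →
        ∀ C₀ : ℝ≥0, 0 < C₀ →
          ∫⁻ t, {t : torusInBorel F E c 2 | C₀ < borelHeight ((t : borelAdelic F E c 2) : (quasiSplit F E c 2).Adelic)}.indicator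
              (fun t => ENNReal.ofReal ((borelHeight ((t : borelAdelic F E c 2) : (quasiSplit F E c 2).Adelic) : ℝ) ^ (-σ))) t *
            wT t ∂μT = K₁ * ENNReal.ofReal ((C₀ : ℝ) ^ (-σ) / σ) := by
  classical
  -- Borel structure and a Haar measure on `𝕀_E` (as in ★ p857484 §2)
  letI : MeasurableSpace (AdeleRing (𝓞 E) E)ˣ := borel _
  haveI : BorelSpace (AdeleRing (𝓞 E) E)ˣ := ⟨rfl⟩
  obtain ⟨hI1, hI2, hI3⟩ := locallyCompactSpace_secondCountable_t2_idele (E := E)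
  set μE : Measure (AdeleRing (𝓞 E) E)ˣ := Measure.haar with hμE
  obtain ⟨𝓕, h𝓕⟩ := exists_isIdeleClassDomain E
  obtain ⟨C, hC0, hCt, hC⟩ := exists_lintegral_comp_diagUnitZero_mul_weight_eq_setLIntegral_two hc μT μE
  refine ⟨C * idelicCovolume E μE, mul_ne_zero hC0 (idelicCovolume_pos μE).ne', ENNReal.mul_ne_top hCt (idelicCovolume_ne_top μE),
    fun wT hwT C₀ hC₀ => ?_⟩
  have hC₀' : (0 : ℝ) < (C₀ : ℝ) := NNReal.coe_pos.2 hC₀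
  -- the integrand as an `E^×`-invariant Borel function of `log ‖d₀ t‖`
  set G : (AdeleRing (𝓞 E) E)ˣ → ℝ≥0∞ := fun x => {x : (AdeleRing (𝓞 E) E)ˣ | ((C₀ : ℝ≥0) : ℝ) < (IdeleClassGroup.ideleNorm E x : ℝ)}.indicator
    (fun x => ENNReal.ofReal ((IdeleClassGroup.ideleNorm E x : ℝ) ^ (-σ))) x with hG
  have hGeq : G = (fun u : ℝ => (Ioi (Real.log C₀)).indicator (fun u => ENNReal.ofReal (Real.exp (-σ * u))) u) ∘ logNorm E :=
    indicator_lt_rpow_neg_eq_comp_logNorm (K := E) hC₀' σ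
  have hGm : Measurable G := by
    rw [hGeq]
    exact ((ENNReal.measurable_ofReal.comp (Real.measurable_exp.comp (measurable_const.mul measurable_id))).indicator measurableSet_Ioi).comp
      (continuous_logNorm E).measurable
  have hGinv : ∀ k ∈ GaloisRepresentations.principalIdeles E, ∀ x, G (k * x) = G x := fun k hk x => by
    rw [hGeq, Function.comp_apply, Function.comp_apply, logNorm_principal_mul hk]
  have hψ : ∀ t : torusInBorel F E c 2,
      {t : torusInBorel F E c 2 | C₀ < borelHeight ((t : borelAdelic F E c 2) : (quasiSplit F E c 2).Adelic)}.indicator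
          (fun t => ENNReal.ofReal ((borelHeight ((t : borelAdelic F E c 2) : (quasiSplit F E c 2).Adelic) : ℝ) ^ (-σ))) t * wT t =
        G (diagUnit (t : borelAdelic F E c 2).2 0) * wT t := by
    intro t
    simp only [hG, Set.indicator, Set.mem_setOf_eq, borelHeight_coe_eq_ideleNorm_diagUnit, NNReal.coe_lt_coe]
  simp_rw [hψ]
  have hwT' : IsCoveringWeight ((rationalBorel F E c 2).subgroupOf (torusInBorel F E c 2)) wT := hwT
  rw [hC wT hwT' 𝓕 h𝓕 G hGm hGinv, hG, setLIntegral_indicator_lt_rpow_neg μE (h𝓕.isFundamentalDomain μE) hσ hC₀', mul_assoc]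

/-- **BOTH SIDES AT `N = 2` UNDER ONE BINDER LIST** (convenience for the `U(Φ₂)` Maass–Selberg assembly): for `c² = 1`, a Haar `μ_T` and `σ > 0`, constants `K₁, K₂ ∈ (0, ∞)` with
`∫⁻ 𝟙{H ≤ C₀} H^σ w_T = K₁ · C₀^σ∕σ` (★ p857484, cited) and `∫⁻ 𝟙{C₀ < H} H^{-σ} w_T = K₂ · C₀^{-σ}∕σ` (above) for every covering weight `w_T` of `T(F)_T` and every `C₀ > 0`.
[cite: MoeglinWaldspurger1995, IV.2.1] [cite: Rogawski1990, §7.3 (p. 98)] -/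
theorem exists_lintegral_indicator_borelHeight_rpow_mul_weight_torus_eq_two_both (hc : c * c = 1)
    (μT : Measure (torusInBorel F E c 2)) [μT.IsHaarMeasure] {σ : ℝ} (hσ : 0 < σ) :
    ∃ K₁ K₂ : ℝ≥0∞, K₁ ≠ 0 ∧ K₁ ≠ ∞ ∧ K₂ ≠ 0 ∧ K₂ ≠ ∞ ∧
      ∀ wT : torusInBorel F E c 2 → ℝ≥0∞,
        IsCoveringWeight ↥((((quasiSplit F E c 2).arithmeticSubgroup).subgroupOf (borelAdelic F E c 2)).subgroupOf
          (torusInBorel F E c 2)) wT →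
        ∀ C₀ : ℝ≥0, 0 < C₀ →
          ∫⁻ t, {t : torusInBorel F E c 2 | borelHeight ((t : borelAdelic F E c 2) : (quasiSplit F E c 2).Adelic) ≤ C₀}.indicator
              (fun t => ENNReal.ofReal ((borelHeight ((t : borelAdelic F E c 2) : (quasiSplit F E c 2).Adelic) : ℝ) ^ σ)) t *
            wT t ∂μT = K₁ * ENNReal.ofReal ((C₀ : ℝ) ^ σ / σ) ∧
          ∫⁻ t, {t : torusInBorel F E c 2 | C₀ < borelHeight ((t : borelAdelic F E c 2) : (quasiSplit F E c 2).Adelic)}.indicator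
              (fun t => ENNReal.ofReal ((borelHeight ((t : borelAdelic F E c 2) : (quasiSplit F E c 2).Adelic) : ℝ) ^ (-σ))) t *
            wT t ∂μT = K₂ * ENNReal.ofReal ((C₀ : ℝ) ^ (-σ) / σ) := by
  obtain ⟨K₁, h1, h1', H1⟩ := K2E1BorelParabolicIntegralU2.exists_lintegral_indicator_borelHeight_rpow_mul_weight_torus_eq_two hc μT hσ
  obtain ⟨K₂, h2, h2', H2⟩ := exists_lintegral_indicator_borelHeight_rpow_neg_mul_weight_torus_eq_two hc μT hσ
  exact ⟨K₁, K₂, h1, h1', h2, h2', fun wT hwT C₀ hC₀ => ⟨H1 wT hwT C₀, H2 wT hwT C₀ hC₀⟩⟩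

end Summit.HodgeConjecture.HodgeConjecture.Cruxes.H413.K2E1TorusHeightMellinU2

end
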